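import Summits.Ventures.YMGap.RobustBall.PeriodisedBox
import Summits.Ventures.YMGap.RobustBall.LatticeSumL1
import Summits.Ventures.YMGap.RobustBall.OneStateInvariant
import Summits.Ventures.YMGap.Thresholds.PlaquetteSusceptibility
import Summits.Ventures.YMGap.Thresholds.MassGapAtMassive
import HarnessLib

/-!
# Venture YMGap, track ROBUST-BALL — THE THERMODYNAMIC VARIANCE DENSITY: for a translation-invariant state with
# absolutely summable autocovariances, `Var(Σ_{x∈B_n} f∘θ_x)/#B_n → Σ_v cov(f, f∘θ_v)`, with an explicit rate

HONEST FRAMING. WHAT THIS IS: a venture file (cell `pub-ymgap`, track Y2 ROBUST-BALL, seat ds-3, theorems only). The cell's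
susceptibility currency (ds-1's C-SUS, `Thresholds/PlaquetteSusceptibility.lean`: `Σ_q |Cov_μ(W_p, W_q)| < ∞`; its C-DIFF
`PressureSecondDerivative`: `p'' =` the plaquette susceptibility) concerns the PLAQUETTE ENERGY. This file is the general
fluctuation–susceptibility identity in the thermodynamic limit, for ANY bounded observable `f` and ANY translation-invariant
state `μ` on the `ℤ^d` link configurations whose autocovariance `c(v) = cov_μ(f, f∘θ_v)` is absolutely summable:

* `covariance_shift_shift` — `cov_μ(f∘θ_x, g∘θ_y) = cov_μ(f, g∘θ_{y−x})` (translation invariance, Mathlib `covariance_map_equiv`);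
* `variance_boxSum_eq` — `Var_μ(Σ_{x∈B_n} f∘θ_x) = Σ_{x∈B_n} Σ_{y∈B_n} c(y − x)` on the centred boxes `B_n = siteBox d n`;
* ★ `abs_variance_boxSum_sub_le` — for all `k ≤ n`:
  `|Var_μ(Σ_{x∈B_n} f∘θ_x) − #B_n · Σ_v c(v)| ≤ #B_n · Σ_{v ∉ B_k} |c(v)| + (#B_n − #B_{n−k}) · Σ_v |c(v)|`
  (inner sites `x ∈ B_{n−k}` miss only the tail beyond `B_k`; the `#B_n − #B_{n−k}` boundary sites at most everything);
* `card_siteBox` — `#B_n = (2n+1)^d`, and ★★ `abs_variance_boxSum_div_sub_le` — the RATE form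
  `|Var_μ(Σ_{B_n} f∘θ_x)/#B_n − Σ_v c(v)| ≤ Σ_{v ∉ B_k} |c(v)| + (2dk/(2n+1)) · Σ_v |c(v)|` (Bernoulli);
* ★★ `tendsto_variance_boxSum_div` — `Var_μ(Σ_{x∈B_n} f∘θ_x)/#B_n → χ(f) := Σ_{v∈ℤ^d} cov_μ(f, f∘θ_v)`: the variance per site
  of a block observable converges to the SUSCEPTIBILITY of `f` (B. Simon, *Lattice Gases* I, §II.12: fluctuations = susceptibility);
* CELL (`su2_wilson_tendsto_variance_boxSum_div`): `SU(2)` lattice Yang–Mills on `ℤ⁴` at every `|β_W| ≤ 9/25` (tree coupling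
  `β_W/2`, the cell's vertex-star window: one translation-invariant DLR state `su2_wilson_oneState_translationInvariant`, massive by
  `isMassiveState_of_massGapAt`): for every bounded measurable gauge-invariant local observable `f` the autocovariance is absolutely
  summable (`summable_abs_of_hasExponentialDecayRate`, rb-p1's `ℓ¹` lattice sum) and the variance density of its block sums converges
  to its susceptibility; `tsum_covariance_shift_nonneg`: the susceptibility is `≥ 0`.
WHAT THIS IS NOT: not a central limit theorem (no Gaussian limit is claimed), not positivity of `χ(f)`; lattice strong coupling for the
cell; nothing about the continuum limit or the Clay problem.

References: B. Simon, *The Statistical Mechanics of Lattice Gases* I (1993), §II.12; H.-O. Georgii, *Gibbs Measures and Phase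
Transitions* (2011), Ch. 5 (translation invariance), §8.2; the tree's `PeriodisedBox.lean` (`siteBox`), `LatticeSumL1.lean`.
-/

noncomputable section

open MeasureTheory Filter Function ProbabilityTheory Real Topology
open scoped NNReal
open Literature.Probability.LatticeModels hiding configShift configShift_apply
open Literature.MathematicalPhysics.QuantumLattice
open Literature.MathematicalPhysics.QuantumFieldTheory hiding ZdEdge Site IsLocalObservable
open Literature.Barriers.QuantumFields (IsMassiveState)
open Summit.Ventures.YMGap.PlaquetteSusceptibility (l1_le_mul_norm)

namespace Summit.Ventures.YMGap.RobustBall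

namespace ThermodynamicVariance

variable {d : ℕ} {G : Type*} [MeasurableSpace G]

/-! ### Translation invariance: covariances of shifted observables -/

/-- **Covariance of two shifted observables under a translation-invariant state**: `cov_μ(f∘θ_x, g∘θ_y) = cov_μ(f, g∘θ_{y−x})`
(`θ_y = θ_{y−x} ∘ θ_x` and `μ ∘ θ_x⁻¹ = μ`; Mathlib `covariance_map_equiv`). [folklore] -/
theorem covariance_shift_shift {μ : Measure (LGConfig d G)} (hμ : IsZdTranslationInvariant μ)
    (f g : LGConfig d G → ℝ) (x y : Site d) :
    cov[fun U => f (configShift x U), fun U => g (configShift y U); μ] =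
      cov[f, fun U => g (configShift (y - x) U); μ] := by
  -- `θ_{y−x} (θ_x U) = θ_y U` (the tree's `CurvatureKernel.LatticeWindow.configShift_configShift`, inlined)
  have hcomp : (fun U => g (configShift y U)) = fun U => g (configShift (y - x) (configShift x U)) := by
    funext U
    congr 1
    funext e
    simp only [configShift_apply]
    congr 1
    ext <;> simp [sub_sub]
  rw [hcomp]
  have h := covariance_map_equiv (μ := μ) f (fun U => g (configShift (y - x) U)) (configShift x)
  rw [hμ x] at h
  exact h.symm

/-- The autocovariance is even: `cov_μ(f, f∘θ_{−v}) = cov_μ(f, f∘θ_v)` for a translation-invariant state. [folklore] -/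
theorem covariance_shift_neg {μ : Measure (LGConfig d G)} (hμ : IsZdTranslationInvariant μ)
    (f : LGConfig d G → ℝ) (v : Site d) :
    cov[f, fun U => f (configShift (-v) U); μ] = cov[f, fun U => f (configShift v U); μ] := by
  have h := covariance_shift_shift hμ f f v 0
  rw [zero_sub] at h
  rw [← h, covariance_comm]
  have h2 := covariance_shift_shift hμ f f 0 v
  rw [sub_zero] at h2
  rw [← h2]

/-! ### The variance of a box sum -/

/-- **Variance of a block sum as a double sum of autocovariances**: for a translation-invariant probability measure and a bounded
measurable `f`, `Var_μ(Σ_{x∈B} f∘θ_x) = Σ_{x∈B} Σ_{y∈B} cov_μ(f, f∘θ_{y−x})` for every finite `B`. [folklore] -/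
theorem variance_boxSum_eq {μ : Measure (LGConfig d G)} [IsProbabilityMeasure μ] (hμ : IsZdTranslationInvariant μ)
    {f : LGConfig d G → ℝ} (hfm : Measurable f) {M : ℝ} (hfb : ∀ U, |f U| ≤ M) (B : Finset (Site d)) :
    Var[fun U => ∑ x ∈ B, f (configShift x U); μ] =
      ∑ x ∈ B, ∑ y ∈ B, cov[f, fun U => f (configShift (y - x) U); μ] := by
  set Fx : Site d → LGConfig d G → ℝ := fun x U => f (configShift x U) with hFx
  have hmem : ∀ x : Site d, MemLp (Fx x) 2 μ := fun x =>
    memLp_of_bounded (a := -M) (b := M) (ae_of_all _ fun U => by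
        simp only [Set.mem_Icc]; exact abs_le.1 (hfb _))
      (hfm.comp (configShift x).measurable).aestronglyMeasurable 2
  have hsum : (fun U => ∑ x ∈ B, f (configShift x U)) = ∑ x ∈ B, Fx x := by funext U; simp [hFx]
  rw [hsum, ← covariance_self (memLp_finsetSum' B fun x _ => hmem x).aestronglyMeasurable.aemeasurable,
    covariance_sum_sum' (fun x _ => hmem x) (fun y _ => hmem y)]
  refine Finset.sum_congr rfl fun x _ => Finset.sum_congr rfl fun y _ => ?_
  exact covariance_shift_shift hμ f f x y

/-! ### The centred boxes -/

/-- `#B_n = (2n+1)^d` for the centred box `B_n = siteBox d n`. [folklore] -/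
theorem card_siteBox (d n : ℕ) : (siteBox d n).card = (2 * n + 1) ^ d := by
  rw [siteBox, Fintype.card_piFinset]
  simp only [Int.card_Icc, Finset.prod_const, Finset.card_univ, Fintype.card_fin]
  congr 1
  have h : ((n : ℤ) + 1 - -(n : ℤ)) = ((2 * n + 1 : ℕ) : ℤ) := by push_cast; ring
  rw [h, Int.toNat_natCast]

/-- The boxes increase: `B_m ⊆ B_n` for `m ≤ n`. [folklore] -/
theorem siteBox_mono {m n : ℕ} (h : m ≤ n) : siteBox d m ⊆ siteBox d n := fun x hx => by
  rw [mem_siteBox_iff_norm] at hx ⊢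
  exact hx.trans (by exact_mod_cast h)

/-- `v ∈ B_k`, `x ∈ B_{n−k}` (`k ≤ n`) ⇒ `v + x ∈ B_n`. [folklore] -/
theorem add_mem_siteBox {n k : ℕ} (hk : k ≤ n) {v x : Site d} (hv : v ∈ siteBox d k) (hx : x ∈ siteBox d (n - k)) :
    v + x ∈ siteBox d n := by
  rw [mem_siteBox_iff_norm] at hv hx ⊢
  calc ‖v + x‖ ≤ ‖v‖ + ‖x‖ := norm_add_le _ _
    _ ≤ k + ((n - k : ℕ) : ℝ) := add_le_add hv hx
    _ = n := by rw [Nat.cast_sub hk]; ring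

/-! ### The main bound: variance of the box sum against `#B_n · χ` -/

/-- **THE THERMODYNAMIC VARIANCE, QUANTITATIVE FORM.** Let `μ` be a translation-invariant probability measure on the `ℤ^d` link
configurations and `f` bounded measurable with absolutely summable autocovariance `c(v) = cov_μ(f, f∘θ_v)`. Then for all `k ≤ n`:
`|Var_μ(Σ_{x∈B_n} f∘θ_x) − #B_n · Σ_v c(v)| ≤ #B_n · Σ_{v ∉ B_k} |c(v)| + (#B_n − #B_{n−k}) · Σ_v |c(v)|` — for an inner site
`x ∈ B_{n−k}` the translates `B_n − x` cover `B_k`, so `x` misses only the tail beyond `B_k`; each of the `#B_n − #B_{n−k}` boundary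
sites misses at most everything. [folklore] -/
theorem abs_variance_boxSum_sub_le {μ : Measure (LGConfig d G)} [IsProbabilityMeasure μ] (hμ : IsZdTranslationInvariant μ)
    {f : LGConfig d G → ℝ} (hfm : Measurable f) {M : ℝ} (hfb : ∀ U, |f U| ≤ M)
    (hsum : Summable fun v : Site d => |cov[f, fun U => f (configShift v U); μ]|) {n k : ℕ} (hk : k ≤ n) :
    |Var[fun U => ∑ x ∈ siteBox d n, f (configShift x U); μ] -
        (siteBox d n).card * ∑' v, cov[f, fun U => f (configShift v U); μ]| ≤
      (siteBox d n).card * (∑' v : {v : Site d // v ∉ siteBox d k}, |cov[f, fun U => f (configShift v U); μ]|) +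
        ((siteBox d n).card - (siteBox d (n - k)).card : ℝ) * ∑' v, |cov[f, fun U => f (configShift v U); μ]| := by
  classical
  set c : Site d → ℝ := fun v => cov[f, fun U => f (configShift v U); μ] with hc
  have hsc : Summable c := hsum.of_abs
  set tail : ℝ := ∑' v : {v : Site d // v ∉ siteBox d k}, |c v| with htail
  set A : ℝ := ∑' v, |c v| with hA
  have htail0 : 0 ≤ tail := tsum_nonneg fun _ => abs_nonneg _
  have hA0 : 0 ≤ A := tsum_nonneg fun _ => abs_nonneg _
  rw [variance_boxSum_eq hμ hfm hfb]
  -- the contribution of one site `x`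
  have hrow : ∀ x ∈ siteBox d n, |∑ y ∈ siteBox d n, c (y - x) - ∑' v, c v| ≤
      if x ∈ siteBox d (n - k) then tail else A := by
    intro x hx
    set T : Finset (Site d) := (siteBox d n).image (fun y => y - x) with hT
    have hinj : Set.InjOn (fun y : Site d => y - x) ↑(siteBox d n) := fun a _ b _ h => sub_left_injective h
    have h1 : ∑ y ∈ siteBox d n, c (y - x) = ∑ v ∈ T, c v := by rw [Finset.sum_image hinj]
    have h2 : ∑ v ∈ T, c v + ∑' v : {v // v ∉ T}, c v = ∑' v, c v := hsc.sum_add_tsum_compl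
    have h3 : ∑ y ∈ siteBox d n, c (y - x) - ∑' v, c v = -∑' v : {v // v ∉ T}, c v := by rw [h1, ← h2]; ring
    rw [h3, abs_neg]
    have hsT : Summable fun v : {v // v ∉ T} => |c v| := hsum.subtype _
    have h4 : |∑' v : {v // v ∉ T}, c v| ≤ ∑' v : {v // v ∉ T}, |c v| := by
      have h := norm_tsum_le_tsum_norm (f := fun v : {v // v ∉ T} => c v) (by simpa [Real.norm_eq_abs] using hsT)
      simpa [Real.norm_eq_abs] using h
    refine h4.trans ?_
    split_ifs with hxin
    · -- inner site: the missed translates lie outside `B_k`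
      have hsub : ∀ v : Site d, v ∉ T → v ∉ siteBox d k := by
        intro v hvT hvk
        refine hvT (Finset.mem_image.2 ⟨v + x, add_mem_siteBox hk hvk hxin, ?_⟩)
        simp
      exact Summable.tsum_le_tsum_of_inj (f := fun v : {v // v ∉ T} => |c v|)
        (g := fun v : {v : Site d // v ∉ siteBox d k} => |c v|)
        (fun v => ⟨v.1, hsub v.1 v.2⟩) (fun a b h => Subtype.ext (by simpa using congrArg Subtype.val h))
        (fun _ _ => abs_nonneg _) (fun _ => le_rfl) hsT (hsum.subtype _)
    · exact Summable.tsum_subtype_le (fun v => |c v|) {v | v ∉ T} (fun _ => abs_nonneg _) hsum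
  -- sum over the sites of the box
  have hsub : siteBox d (n - k) ⊆ siteBox d n := siteBox_mono (Nat.sub_le n k)
  have hcard : ((siteBox d (n - k)).card : ℝ) ≤ (siteBox d n).card := by exact_mod_cast Finset.card_le_card hsub
  calc |∑ x ∈ siteBox d n, ∑ y ∈ siteBox d n, c (y - x) - (siteBox d n).card * ∑' v, c v|
      = |∑ x ∈ siteBox d n, (∑ y ∈ siteBox d n, c (y - x) - ∑' v, c v)| := by
        rw [Finset.sum_sub_distrib, Finset.sum_const, nsmul_eq_mul]
    _ ≤ ∑ x ∈ siteBox d n, |∑ y ∈ siteBox d n, c (y - x) - ∑' v, c v| := Finset.abs_sum_le_sum_abs _ _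
    _ ≤ ∑ x ∈ siteBox d n, (if x ∈ siteBox d (n - k) then tail else A) := Finset.sum_le_sum hrow
    _ = (siteBox d (n - k)).card * tail + ((siteBox d n).card - (siteBox d (n - k)).card : ℝ) * A := by
        rw [Finset.sum_ite, Finset.sum_const, Finset.sum_const, nsmul_eq_mul, nsmul_eq_mul,
          Finset.filter_mem_eq_inter, Finset.inter_eq_right.2 hsub, Finset.filter_not, Finset.filter_mem_eq_inter,
          Finset.inter_eq_right.2 hsub, Finset.card_sdiff_of_subset hsub, Nat.cast_sub (Finset.card_le_card hsub)]
    _ ≤ (siteBox d n).card * tail + ((siteBox d n).card - (siteBox d (n - k)).card : ℝ) * A := by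
        gcongr

/-! ### The rate form and the thermodynamic limit -/

/-- Bernoulli: `1 − #B_{n−k}/#B_n ≤ 2dk/(2n+1)` for `k ≤ n`. [folklore] -/
theorem one_sub_card_ratio_le {n k : ℕ} (hk : k ≤ n) :
    1 - ((siteBox d (n - k)).card : ℝ) / (siteBox d n).card ≤ 2 * (d : ℝ) * k / (2 * n + 1) := by
  rw [card_siteBox, card_siteBox]
  push_cast
  have hn : (0 : ℝ) < 2 * n + 1 := by positivity
  set a : ℝ := -(2 * (k : ℝ) / (2 * n + 1)) with ha
  have h1 : (2 * ((n - k : ℕ) : ℝ) + 1) / (2 * n + 1) = 1 + a := by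
    rw [Nat.cast_sub hk, ha]
    field_simp
    ring
  rw [← div_pow, h1]
  have hk' : (2 * (k : ℝ)) / (2 * n + 1) ≤ 1 := by
    rw [div_le_one hn]
    have : (k : ℝ) ≤ n := by exact_mod_cast hk
    linarith
  have hB := one_add_mul_le_pow (a := a) (by rw [ha]; linarith [show (0:ℝ) ≤ 2 * k / (2 * n + 1) by positivity]) d
  have e : (d : ℝ) * a = -(2 * (d : ℝ) * k / (2 * n + 1)) := by rw [ha]; ring
  linarith

/-- ★★ **THE THERMODYNAMIC VARIANCE, RATE FORM**: under the hypotheses of `abs_variance_boxSum_sub_le`, for all `k ≤ n`: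
`|Var_μ(Σ_{x∈B_n} f∘θ_x)/#B_n − Σ_v cov_μ(f, f∘θ_v)| ≤ Σ_{v ∉ B_k} |c(v)| + (2dk/(2n+1)) · Σ_v |c(v)|` — the variance per site of
the block sum is the susceptibility up to a tail and a surface/volume term. [folklore] -/
theorem abs_variance_boxSum_div_sub_le {μ : Measure (LGConfig d G)} [IsProbabilityMeasure μ]
    (hμ : IsZdTranslationInvariant μ) {f : LGConfig d G → ℝ} (hfm : Measurable f) {M : ℝ} (hfb : ∀ U, |f U| ≤ M)
    (hsum : Summable fun v : Site d => |cov[f, fun U => f (configShift v U); μ]|) {n k : ℕ} (hk : k ≤ n) :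
    |Var[fun U => ∑ x ∈ siteBox d n, f (configShift x U); μ] / (siteBox d n).card -
        ∑' v, cov[f, fun U => f (configShift v U); μ]| ≤
      (∑' v : {v : Site d // v ∉ siteBox d k}, |cov[f, fun U => f (configShift v U); μ]|) +
        2 * (d : ℝ) * k / (2 * n + 1) * ∑' v, |cov[f, fun U => f (configShift v U); μ]| := by
  have hB : (0 : ℝ) < (siteBox d n).card := by rw [card_siteBox]; positivity
  have key := abs_variance_boxSum_sub_le hμ hfm hfb hsum hk
  have hA0 : 0 ≤ ∑' v, |cov[f, fun U => f (configShift v U); μ]| := tsum_nonneg fun _ => abs_nonneg _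
  have e : Var[fun U => ∑ x ∈ siteBox d n, f (configShift x U); μ] / (siteBox d n).card -
      ∑' v, cov[f, fun U => f (configShift v U); μ] =
      (Var[fun U => ∑ x ∈ siteBox d n, f (configShift x U); μ] -
        (siteBox d n).card * ∑' v, cov[f, fun U => f (configShift v U); μ]) / (siteBox d n).card := by
    field_simp
  rw [e, abs_div, abs_of_pos hB, div_le_iff₀ hB]
  refine key.trans ?_
  have hratio := one_sub_card_ratio_le (d := d) hk
  have h2 : ((siteBox d n).card - (siteBox d (n - k)).card : ℝ) ≤ 2 * (d : ℝ) * k / (2 * n + 1) * (siteBox d n).card := by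
    have : ((siteBox d n).card - (siteBox d (n - k)).card : ℝ) =
        (1 - ((siteBox d (n - k)).card : ℝ) / (siteBox d n).card) * (siteBox d n).card := by
      field_simp
    rw [this]
    exact mul_le_mul_of_nonneg_right hratio hB.le
  calc (siteBox d n).card * (∑' v : {v : Site d // v ∉ siteBox d k}, |cov[f, fun U => f (configShift v U); μ]|) +
        ((siteBox d n).card - (siteBox d (n - k)).card : ℝ) * ∑' v, |cov[f, fun U => f (configShift v U); μ]|
      ≤ (siteBox d n).card * (∑' v : {v : Site d // v ∉ siteBox d k}, |cov[f, fun U => f (configShift v U); μ]|) +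
        (2 * (d : ℝ) * k / (2 * n + 1) * (siteBox d n).card) * ∑' v, |cov[f, fun U => f (configShift v U); μ]| := by
        gcongr
    _ = ((∑' v : {v : Site d // v ∉ siteBox d k}, |cov[f, fun U => f (configShift v U); μ]|) +
        2 * (d : ℝ) * k / (2 * n + 1) * ∑' v, |cov[f, fun U => f (configShift v U); μ]|) * (siteBox d n).card := by ring

/-- ★★ **THE THERMODYNAMIC VARIANCE DENSITY IS THE SUSCEPTIBILITY** (B. Simon, *Lattice Gases* I, §II.12): for a translation-invariant
probability measure `μ` on the `ℤ^d` link configurations and a bounded measurable `f` with absolutely summable autocovariance,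
`Var_μ(Σ_{x∈B_n} f∘θ_x)/#B_n → χ(f) := Σ_{v∈ℤ^d} cov_μ(f, f∘θ_v)` as `n → ∞`. [folklore] -/
theorem tendsto_variance_boxSum_div {μ : Measure (LGConfig d G)} [IsProbabilityMeasure μ]
    (hμ : IsZdTranslationInvariant μ) {f : LGConfig d G → ℝ} (hfm : Measurable f) {M : ℝ} (hfb : ∀ U, |f U| ≤ M)
    (hsum : Summable fun v : Site d => |cov[f, fun U => f (configShift v U); μ]|) :
    Tendsto (fun n : ℕ => Var[fun U => ∑ x ∈ siteBox d n, f (configShift x U); μ] / (siteBox d n).card) atTop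
      (𝓝 (∑' v, cov[f, fun U => f (configShift v U); μ])) := by
  classical
  set c : Site d → ℝ := fun v => cov[f, fun U => f (configShift v U); μ] with hc
  set A : ℝ := ∑' v, |c v| with hA
  have hA0 : 0 ≤ A := tsum_nonneg fun _ => abs_nonneg _
  rw [Metric.tendsto_atTop]
  intro ε hε
  -- the tails of the absolutely convergent autocovariance series are eventually small
  have htails := tendsto_tsum_compl_atTop_zero (fun v : Site d => |c v|)
  obtain ⟨s₀, hs₀⟩ := Metric.tendsto_atTop.1 htails (ε / 2) (half_pos hε)
  obtain ⟨L, hL⟩ := (eventually_subset_siteBox (d := d) s₀).exists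
  set k₀ : ℕ := L / 2 with hk₀
  have htail : ∑' v : {v : Site d // v ∉ siteBox d k₀}, |c v| < ε / 2 := by
    have h := hs₀ (siteBox d k₀) hL
    rw [Real.dist_eq, sub_zero, abs_of_nonneg (tsum_nonneg fun _ => abs_nonneg _)] at h
    exact h
  -- the surface/volume term is eventually small
  obtain ⟨N₁, hN₁⟩ := Metric.tendsto_atTop.1 (tendsto_const_div_atTop_nhds_zero_nat (2 * (d : ℝ) * k₀ * A)) (ε / 2) (half_pos hε)
  refine ⟨max k₀ (max N₁ 1), fun n hn => ?_⟩
  have hnk : k₀ ≤ n := le_trans (le_max_left _ _) hn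
  have hnN : N₁ ≤ n := le_trans ((le_max_left _ _).trans (le_max_right _ _)) hn
  have hn1 : 1 ≤ n := le_trans ((le_max_right _ _).trans (le_max_right _ _)) hn
  have hsurf : 2 * (d : ℝ) * k₀ / (2 * n + 1) * A < ε / 2 := by
    have h := hN₁ n hnN
    rw [Real.dist_eq, sub_zero, abs_of_nonneg (by positivity)] at h
    have hnpos : (0 : ℝ) < n := by exact_mod_cast hn1
    calc 2 * (d : ℝ) * k₀ / (2 * n + 1) * A = (2 * (d : ℝ) * k₀ * A) / (2 * n + 1) := by ring
      _ ≤ (2 * (d : ℝ) * k₀ * A) / n :=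
          div_le_div_of_nonneg_left (by positivity) hnpos (by linarith)
      _ < ε / 2 := h
  rw [Real.dist_eq]
  calc |Var[fun U => ∑ x ∈ siteBox d n, f (configShift x U); μ] / (siteBox d n).card - ∑' v, c v|
      ≤ (∑' v : {v : Site d // v ∉ siteBox d k₀}, |c v|) + 2 * (d : ℝ) * k₀ / (2 * n + 1) * A :=
        abs_variance_boxSum_div_sub_le hμ hfm hfb hsum hnk
    _ < ε / 2 + ε / 2 := add_lt_add htail hsurf
    _ = ε := by ring

/-- **The susceptibility is nonnegative**: under the same hypotheses `0 ≤ Σ_{v∈ℤ^d} cov_μ(f, f∘θ_v)` — it is the limit of the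
nonnegative variance densities (a positivity statement about the whole autocovariance series, not about its terms). [folklore] -/
theorem tsum_covariance_shift_nonneg {μ : Measure (LGConfig d G)} [IsProbabilityMeasure μ]
    (hμ : IsZdTranslationInvariant μ) {f : LGConfig d G → ℝ} (hfm : Measurable f) {M : ℝ} (hfb : ∀ U, |f U| ≤ M)
    (hsum : Summable fun v : Site d => |cov[f, fun U => f (configShift v U); μ]|) :
    0 ≤ ∑' v, cov[f, fun U => f (configShift v U); μ] :=
  ge_of_tendsto' (tendsto_variance_boxSum_div hμ hfm hfb hsum) fun _ =>
    div_nonneg (variance_nonneg _ _) (Nat.cast_nonneg _)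

/-! ### Absolute summability from an exponential decay rate; the `SU(2)` cell -/

/-- An `ℓ^∞`-exponentially decaying lattice function is absolutely summable over `ℤ^d` (`d ≥ 1`; `‖x‖_∞ ≥ ‖x‖₁/d` and rb-p1's
`ℓ¹` lattice sum). [folklore] -/
theorem summable_abs_of_exp_decay (hd : 1 ≤ d) {g : Site d → ℝ} {m C : ℝ} (hm : 0 < m)
    (hg : ∀ x, |g x| ≤ C * exp (-m * ‖x‖)) : Summable fun x => |g x| := by
  have hd0 : (0 : ℝ) < d := by exact_mod_cast hd
  set r : ℝ := exp (-(m / d)) with hr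
  have hr0 : 0 ≤ r := (exp_pos _).le
  have hr1 : r < 1 := Real.exp_lt_one_iff.2 (neg_neg_of_pos (by positivity))
  have hbound : ∀ x, |g x| ≤ max C 0 * r ^ l1 ((0 : Site d) - x) := by
    intro x
    rw [zero_sub, l1_neg]
    have h3 : exp (-m * ‖x‖) ≤ r ^ l1 x := by
      rw [hr, ← Real.exp_nat_mul]
      refine exp_le_exp.2 ?_
      have hl : (l1 x : ℝ) ≤ d * ‖x‖ := l1_le_mul_norm x
      have : (l1 x : ℝ) * (m / d) ≤ m * ‖x‖ := by
        rw [mul_div_assoc', div_le_iff₀ hd0]; nlinarith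
      linarith
    calc |g x| ≤ C * exp (-m * ‖x‖) := hg x
      _ ≤ max C 0 * exp (-m * ‖x‖) := mul_le_mul_of_nonneg_right (le_max_left _ _) (exp_pos _).le
      _ ≤ max C 0 * r ^ l1 x := mul_le_mul_of_nonneg_left h3 (le_max_right _ _)
  exact Summable.of_nonneg_of_le (fun x => abs_nonneg _) hbound
    (((summable_pow_l1_sub hr0 hr1 (0 : Site d)).1).mul_left (max C 0))

/-- ★★ **CELL — `SU(2)` LATTICE YANG–MILLS ON `ℤ⁴` IN THE VERTEX-STAR WINDOW `|β_W| ≤ 9/25`** (tree coupling `b = β_W/2`,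
`|b| ≤ 9/50`): the unique DLR state `μ` is translation invariant (`su2_wilson_oneState_translationInvariant`) and massive
(`isMassiveState_of_massGapAt`, `ImprovedThresholdStar.su2_massGapAt_of_abs_le`), hence for EVERY bounded measurable
gauge-invariant local observable `F`: the autocovariance `v ↦ cov_μ(F, F∘θ_v)` is absolutely summable over `ℤ⁴` and
`Var_μ(Σ_{x∈B_n} F∘θ_x)/#B_n → Σ_v cov_μ(F, F∘θ_v)` — the thermodynamic fluctuation density of every such observable is its
susceptibility. [folklore] -/
theorem su2_wilson_tendsto_variance_boxSum_div {b : ℝ} (hb : |b| ≤ 9 / 50) :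
    ∃ μ : Measure (LGConfig 4 (Matrix.specialUnitaryGroup (Fin 2) ℂ)),
      ymGibbsMeasures (d := 4) (fundamentalRep (Fin 2)) b = {μ} ∧
      ∀ F : LGConfig 4 (Matrix.specialUnitaryGroup (Fin 2) ℂ) → ℝ,
        Literature.MathematicalPhysics.QuantumLattice.IsLocalObservable F → Measurable F → (∃ C, ∀ U, |F U| ≤ C) →
        IsZdGaugeInvariant F →
          Summable (fun v : Site 4 => |cov[F, fun U => F (configShift v U); μ]|) ∧
          Tendsto (fun n : ℕ => Var[fun U => ∑ x ∈ siteBox 4 n, F (configShift x U); μ] / (siteBox 4 n).card) atTop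
            (𝓝 (∑' v, cov[F, fun U => F (configShift v U); μ])) := by
  obtain ⟨μ, hG, hinv⟩ := su2_wilson_oneState_translationInvariant hb
  have hμ : μ ∈ ymGibbsMeasures (d := 4) (fundamentalRep (Fin 2)) b := by rw [hG]; exact Set.mem_singleton μ
  have hb' : |b / 2| ≤ 9 / 100 := by rw [abs_div, abs_two]; linarith
  have hμ2 : μ ∈ ymGibbsMeasures (d := 4) (fundamentalRep (Fin 2)) (((2 : ℕ) : ℝ) * (b / 2)) := by
    have e : (((2 : ℕ) : ℝ) * (b / 2)) = b := by push_cast; ring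
    rw [e]; exact hμ
  have hmass : IsMassiveState μ :=
    Summit.Ventures.YMGap.MassGapMassive.isMassiveState_of_massGapAt (N := 2) (by norm_num)
      (ImprovedThresholdStar.su2_massGapAt_of_abs_le hb') μ hμ2
  have hμG : IsGibbsMeasure (ymSpecification (d := 4) (fundamentalRep (Fin 2)) b) μ := hμ
  haveI := hμG.isProbabilityMeasure
  refine ⟨μ, hG, fun F hloc hFm hFb hFg => ?_⟩
  obtain ⟨m, hm⟩ := hmass
  obtain ⟨hm0, C, hC⟩ := hm F F hloc hloc hFm hFm hFb hFb hFg hFg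
  obtain ⟨M, hM⟩ := hFb
  have hs : Summable fun v : Site 4 => |cov[F, fun U => F (configShift v U); μ]| :=
    summable_abs_of_exp_decay (d := 4) (by norm_num) hm0 hC
  exact ⟨hs, tendsto_variance_boxSum_div hinv hFm hM hs⟩

end ThermodynamicVariance

end Summit.Ventures.YMGap.RobustBall

end
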